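import Summits.BirchSwinnertonDyer.BirchSwinnertonDyer.Theorems.KolyvaginDepthDoorKolyvaginDepthSupplyDoorSecondSign
import HarnessLib

/-!
# Route `KolyvaginDepthDoor`, crux `KolyvaginDepthSupply` (stmt-BirchSwinnertonDyer-21765) —
# THE LOWER BOUND ON THE DEPTH OF ANY NON-ZERO LEVEL-1 KOLYVAGIN CLASS, points first and bit-free:
# `ν(n) + 1 ≥ max(rank E(ℚ), rank E^{(d_K)}(ℚ))` and `2ν(n) + 1 ≥ rank E(ℚ) + rank E^{(d_K)}(ℚ)`;
# every class of depth `≤ rank E(ℚ) − 2` VANISHES (no Kolyvagin Thm. 4, no bit)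

Helper file (`--supports stmt-BirchSwinnertonDyer-21765 --as helper`); it closes nothing and BSD is
not proved by it.

The route's title reads X1 at rank `≥ 2` as "non-vanishing of the FIRST admissible Kolyvagin class
(depth = rank − 1)". The doors of g5–g9 read a non-zero class UPWARD (`c_1(n) ≠ 0` at depth `ν` with
`ν + 1 ≤ rank` ⟹ `t_p = 0`, `rank = ν + 1`). This file records the complementary, BIT-FREE half, which
the same proved descent yields and no file states: a non-zero level-1 class of depth `ν` FORCES
`rank E(ℚ) ≤ ν + 1`, `rank E^{(d_K)}(ℚ) ≤ ν + 1` and `rank E(ℚ) + rank E^{(d_K)}(ℚ) ≤ 2ν + 1` — Kolyvagin's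
signed bounds `#Sel_p(E/K)^{±e} ≤ p^{ν+1}, p^{ν}` (`card_sel_le_of_ne_zero`, proved algebra) against the
Kummer images `p^{rank} ≤ #Sel_p` over `ℚ` on `E` and on `E^{(d_K)}` (both halves of Gross (5.1) at finite
level, proved). Contrapositively: **every level-1 Kolyvagin class of depth `ν ≤ rank E(ℚ) − 2` (or
`≤ rank E^{(d_K)}(ℚ) − 2`, or with `2ν + 2 ≤ rank E + rank E^{(d_K)}`) is ZERO** — the points-first shadow
of Kolyvagin's `ν_min = max(r_p^+, r_p^−) − 1` (1991, Thm. 4), obtained WITHOUT the structure theorem and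
WITHOUT any computed bit. For the depth table: on the 18 rank-2 curves every depth-0 class vanishes
(`δ y_K ≡ 0 (mod p)`), on the rank-3 curves every depth-`≤ 1` class `c_1(ℓ)` vanishes — falsifiable
per-row PREDICTIONS of the instrument (a computed `c_1(ℓ) ≠ 0` on `5077a1` would refute (γ) ∧ KN-reading
or the rank certificate, not BSD).

* `rank_le_of_ne_zero_of_hypothesesDepth` — abstract (any `HypothesesDepth` pinned to `Sel(E/K)`,
  `conjAct`, `p`): `S.c n₁ ≠ 0` ⟹ `(rank E ≤ ν+1 ∧ rank E^{(d_K)} ≤ ν) ∨ (rank E ≤ ν ∧ rank E^{(d_K)} ≤ ν+1)`.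
* `eq_zero_of_rank_of_hypothesesDepth` — abstract vanishing below the points.
* datum versions on print-standard inputs ((γ) through g8's `exists_hypothesesDepth_of_datum_of_hfin`):
  `rank_le_of_kolyvaginClass_ne_zero_of_datum_{of_hfin,kodairaNeron,gross1991E0}` and
  `kolyvaginClass_eq_zero_of_rank_of_datum_{kodairaNeron,gross1991E0}`.

CONDITIONAL on (γ) = `GrossLMS1991.prop37_2_frobeniusCongruence` [+ F1 off the Kodaira–Néron cell];
per-curve in form but with NO bit; nothing class-wide about X1 is asserted; BSD is not proved by it.

References: [Kolyvagin1991MathAnn] Thm. 2.3, Thm. 4 (`ν = max(r^+, r^−) − 1`); [GrossLMS1991] §5 (5.1),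
§10; [McCallumLMS1991] §5 Thm. 5.4, 5.8; [SilvermanAEC2009] Thm. X.4.2.
-/

set_option linter.dupNamespace false

noncomputable section

open scoped Classical

namespace Summit.BirchSwinnertonDyer.BirchSwinnertonDyer.Theorems.KolyvaginDepthDoor

open Literature.NumberTheory.EllipticCurves Literature.NumberTheory.EllipticCurves.ModularForms
  Literature.NumberTheory.EllipticCurves.KolyvaginDescent
  Literature.NumberTheory.EllipticCurves.McCallum1991 WeierstrassCurve NumberField IsDedekindDomain
open Literature.NumberTheory.DiophantineGeometry (KodairaSymbol)

/-! ## §0 The Kummer lower bound `n^{rank} ≤ #Sel^(n)` (unconditional) -/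

/-- **`n^{rank E(F)} ≤ #Sel^(n)(E/F)`** over a number field (`n ≠ 0`): the exact descent count
`#Sel^(n) = n^{rank} · #E(F)[n] · #Ш[n]` (`natCard_selmerGroup_eq`, Silverman X.4.2) with both extra
factors positive (the Selmer group is finite, `finite_selmerGroup_holds`). Unconditional.
[cite: SilvermanAEC2009, Thm X.4.2] -/
theorem pow_rank_le_natCard_selmerGroup_of_ne_zero {F : Type*} [Field F] [NumberField F]
    (W : WeierstrassCurve F) [W.IsElliptic] {n : ℕ} (hn : n ≠ 0) :
    n ^ W.mordellWeilRank ≤ Nat.card ↥(selmerGroup W (n : ℤ)) := by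
  have hcount := W.natCard_selmerGroup_eq hn
  haveI hfinSel : Finite ↥(selmerGroup W (n : ℤ)) :=
    W.finite_selmerGroup_holds (by exact_mod_cast hn)
  have hSelpos : 0 < Nat.card ↥(selmerGroup W (n : ℤ)) := Nat.card_pos
  set t := Nat.card ↥(AddSubgroup.torsionBy W.toAffine.Point (n : ℤ)) with ht_def
  set u := Nat.card ↥(W.sha ⊓ AddSubgroup.torsionBy W.galH1 (n : ℤ)) with hu_def
  rw [hcount] at hSelpos ⊢
  have ht0 : 0 < t := Nat.pos_of_ne_zero fun h ↦ by
    rw [h, mul_zero, zero_mul] at hSelpos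
    exact lt_irrefl 0 hSelpos
  have hu0 : 0 < u := Nat.pos_of_ne_zero fun h ↦ by
    rw [h, mul_zero] at hSelpos
    exact lt_irrefl 0 hSelpos
  rw [mul_assoc]
  exact Nat.le_mul_of_pos_right _ (Nat.mul_pos ht0 hu0)

/-! ## §1 The abstract lower bound on the depth of a non-zero class -/

/-- **A non-zero class of depth `ν` bounds BOTH ranks (Kolyvagin's `ν ≥ max(r^+, r^−) − 1`, points
first).** `E/ℚ` elliptic, `K` quadratic with non-trivial automorphism `c`, `p` odd, `m = p`, `S` descent
data on `H¹(K, E[m])` pinned to `Sel(E/K)`, `conjAct W c`, `p`; if `S.c n₁ ≠ 0` at a square-free product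
`n₁` of `S`-Kolyvagin primes with `ν` prime factors then EITHER `rank E(ℚ) ≤ ν + 1 ∧ rank E^{(d_K)}(ℚ) ≤ ν`
(the class sits on the `+` side) OR `rank E(ℚ) ≤ ν ∧ rank E^{(d_K)}(ℚ) ≤ ν + 1` (the `−` side). Proof:
signed bounds `#Sel^{e} ≤ p^{ν+1}`, `#Sel^{−e} ≤ p^{ν}` (`card_sel_le_of_ne_zero`); `Sel_p(E/ℚ) ↪ Sel^+`,
`Sel_p(E^{(d_K)}/ℚ) ↪ Sel^−` (`natCard_selmerGroup_le_of_forall_mem_of_finrank_eq_two`,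
`natCard_selmerGroup_quadraticTwist_discr_le_of_forall_mem`); Kummer `p^{rank} ≤ #Sel_p`. No bit beyond
`≠ 0`, no point hypothesis, no structure theorem. [cite: Kolyvagin1991MathAnn, Thm. 2.3 and Thm. 4]
[cite: GrossLMS1991, §5 (5.1) and §10] [cite: SilvermanAEC2009, Thm X.4.2] -/
theorem rank_le_of_ne_zero_of_hypothesesDepth (W : WeierstrassCurve ℚ) [W.IsElliptic] (K : Type)
    [Field K] [NumberField K] (hK2 : Module.finrank ℚ K = 2) (c : K ≃ₐ[ℚ] K) (hc : c ≠ 1)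
    (p : ℕ) [hp : Fact p.Prime] (hp2 : p ≠ 2) {m : ℕ} (hm : m = p) {Pl : Type*}
    (S : HypothesesDepth (galH1Torsion (W.baseChange K) (m : ℤ)) Pl)
    (hSel : S.Sel = selmerGroup (W.baseChange K) (m : ℤ)) (hSp : S.p = p)
    (hSτ : S.τ = conjAct W c (m : ℤ))
    {n₁ : ℕ} (hn₁ : KolSupp S.Kol n₁) (hne : S.c n₁ ≠ 0) :
    (W.mordellWeilRank ≤ n₁.primeFactors.card + 1 ∧
        (W.quadraticTwist (NumberField.discr K : ℚ)).mordellWeilRank ≤ n₁.primeFactors.card) ∨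
      (W.mordellWeilRank ≤ n₁.primeFactors.card ∧
        (W.quadraticTwist (NumberField.discr K : ℚ)).mordellWeilRank ≤ n₁.primeFactors.card + 1) := by
  subst hm
  have hpP : m.Prime := hp.out
  set ν := n₁.primeFactors.card with hν
  have hdK : (NumberField.discr K : ℚ) ≠ 0 := by exact_mod_cast NumberField.discr_ne_zero K
  haveI := W.isElliptic_quadraticTwist hdK
  -- Kolyvagin's signed bounds at the minimal depth
  obtain ⟨-, -, e, he, hfinE, hcardE, hfinO, hcardO⟩ := S.card_sel_le_of_ne_zero hn₁ hne
  rw [hSp] at hcardE hcardO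
  haveI := hfinE
  haveI := hfinO
  have hT1 : ∀ s ∈ selmerGroup (W.baseChange K) (m : ℤ), conjAct W c (m : ℤ) s = (1 : ℤ) • s →
      s ∈ S.eigenSel 1 := fun s hs hτ ↦ by
    rw [S.mem_eigenSel, hSel, hSτ]
    exact ⟨hs, hτ⟩
  have hTm : ∀ s ∈ selmerGroup (W.baseChange K) (m : ℤ), conjAct W c (m : ℤ) s = (-1 : ℤ) • s →
      s ∈ S.eigenSel (-1) := fun s hs hτ ↦ by
    rw [S.mem_eigenSel, hSel, hSτ]
    exact ⟨hs, hτ⟩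
  -- Kummer lower bounds over `ℚ`
  have hlowE := pow_rank_le_natCard_selmerGroup_of_ne_zero W hpP.ne_zero
  have hlowT := pow_rank_le_natCard_selmerGroup_of_ne_zero
    (W.quadraticTwist (NumberField.discr K : ℚ)) hpP.ne_zero
  rcases he with h | h
  · subst h
    left
    obtain ⟨-, hcardQ⟩ := natCard_selmerGroup_le_of_forall_mem_of_finrank_eq_two K W c hK2 hc hpP
      hp2 (S.eigenSel 1) hT1
    obtain ⟨-, hcardT⟩ := natCard_selmerGroup_quadraticTwist_discr_le_of_forall_mem W K hK2 c hc hpP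
      hp2 (S.eigenSel (-1)) hTm
    exact ⟨(Nat.pow_le_pow_iff_right hpP.one_lt).mp (hlowE.trans (hcardQ.trans hcardE)),
      (Nat.pow_le_pow_iff_right hpP.one_lt).mp (hlowT.trans (hcardT.trans hcardO))⟩
  · subst h
    right
    rw [neg_neg] at hfinO hcardO
    haveI := hfinO
    obtain ⟨-, hcardQ⟩ := natCard_selmerGroup_le_of_forall_mem_of_finrank_eq_two K W c hK2 hc hpP
      hp2 (S.eigenSel 1) hT1
    obtain ⟨-, hcardT⟩ := natCard_selmerGroup_quadraticTwist_discr_le_of_forall_mem W K hK2 c hc hpP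
      hp2 (S.eigenSel (-1)) hTm
    exact ⟨(Nat.pow_le_pow_iff_right hpP.one_lt).mp (hlowE.trans (hcardQ.trans hcardO)),
      (Nat.pow_le_pow_iff_right hpP.one_lt).mp (hlowT.trans (hcardT.trans hcardE))⟩

/-- **Vanishing below the points (abstract).** Same setting; if `rank E(ℚ) ≥ ν + 2`, or
`rank E^{(d_K)}(ℚ) ≥ ν + 2`, or both ranks are `≥ ν + 1`, then every class `S.c n₁` of depth `ν` is ZERO.
[cite: Kolyvagin1991MathAnn, Thm. 2.3 and Thm. 4] [cite: GrossLMS1991, §5 (5.1) and §10] -/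
theorem eq_zero_of_rank_of_hypothesesDepth (W : WeierstrassCurve ℚ) [W.IsElliptic] (K : Type)
    [Field K] [NumberField K] (hK2 : Module.finrank ℚ K = 2) (c : K ≃ₐ[ℚ] K) (hc : c ≠ 1)
    (p : ℕ) [hp : Fact p.Prime] (hp2 : p ≠ 2) {m : ℕ} (hm : m = p) {Pl : Type*}
    (S : HypothesesDepth (galH1Torsion (W.baseChange K) (m : ℤ)) Pl)
    (hSel : S.Sel = selmerGroup (W.baseChange K) (m : ℤ)) (hSp : S.p = p)
    (hSτ : S.τ = conjAct W c (m : ℤ))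
    {n₁ : ℕ} (hn₁ : KolSupp S.Kol n₁)
    (hrank : n₁.primeFactors.card + 2 ≤ W.mordellWeilRank ∨
      n₁.primeFactors.card + 2 ≤ (W.quadraticTwist (NumberField.discr K : ℚ)).mordellWeilRank ∨
      (n₁.primeFactors.card + 1 ≤ W.mordellWeilRank ∧
        n₁.primeFactors.card + 1 ≤ (W.quadraticTwist (NumberField.discr K : ℚ)).mordellWeilRank)) :
    S.c n₁ = 0 := by
  by_contra hne
  rcases rank_le_of_ne_zero_of_hypothesesDepth W K hK2 c hc p hp2 hm S hSel hSp hSτ hn₁ hne with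
    ⟨h1, h2⟩ | ⟨h1, h2⟩ <;> omega

/-! ## §2 On the route's objects: any datum, print-standard inputs -/

section Datum

variable {W : WeierstrassCurve ℚ} [W.IsElliptic] [W.IsGloballyMinimal] [NeZero (W.conductorNorm ℤ)]
  {K : Type} [Field K] [NumberField K]
  {Dt : ModularParametrizationData W (W.conductorNorm ℤ)} {β : ℤ} {ι : K →+* ℂ}

/-- **A non-zero level-1 Kolyvagin class of depth `ν` bounds both ranks — any datum, `hfin` displayed.**
`E/ℚ` globally minimal without CM, `K` imaginary quadratic with `d_K ∉ {−3, −4}` and the Heegner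
hypothesis for `N_E`, `c` its complex conjugation, `p` odd with `ρ̄_{E,p^n}` onto for all `n`, a frame
`(Dt, β, ι)`, (γ) = `GrossLMS1991.prop37_2_frobeniusCongruence` and the finite local clause `hfin`; for
ANY datum `d₁` of square-free conductor `n₁` with `ν` Zhang–Kolyvagin prime factors: `c_1(n₁) ≠ 0` ⟹
`(rank E(ℚ) ≤ ν+1 ∧ rank E^{(d_K)}(ℚ) ≤ ν) ∨ (rank E(ℚ) ≤ ν ∧ rank E^{(d_K)}(ℚ) ≤ ν+1)`. CONDITIONAL on
(γ) and `hfin`; BSD is not proved by it. [cite: Kolyvagin1991MathAnn, Thm. 2.3 and Thm. 4]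
[cite: GrossLMS1991, Prop. 3.7 (2), §5 (5.1), §10] [cite: McCallumLMS1991, §§2–5] -/
theorem rank_le_of_kolyvaginClass_ne_zero_of_datum_of_hfin
    (h372 : GrossLMS1991.prop37_2_frobeniusCongruence)
    (hcm : ¬ W.HasCM) (hK : IsImaginaryQuadratic K) (hD3 : NumberField.discr K ≠ -3)
    (hD4 : NumberField.discr K ≠ -4) (hH : SatisfiesHeegnerHypothesis (W.conductorNorm ℤ) K)
    (p : ℕ) [hp : Fact p.Prime] (hp2 : p ≠ 2)
    (htower : ∀ n : ℕ, W.HasSurjectiveModNGaloisRep (p ^ n : ℕ))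
    (c : K ≃ₐ[ℚ] K) (hc : c ≠ 1) (hcc : c * c = 1)
    (hfin : ∀ (n : ℕ), Squarefree n →
      (∀ q ∈ n.primeFactors, Zhang2014.IsKolyvaginPrime (W.conductorNorm ℤ) W K p q) →
      ∀ (d : KolyvaginHeegnerData Dt β ι n) (v : HeightOneSpectrum (𝓞 K)), (n : 𝓞 K) ∉ v.asIdeal →
        d.kolyvaginClass hp.out 1 ∈ selmerLocalKer (W.baseChange K) (v.adicCompletion K) ((p ^ 1 : ℕ) : ℤ))
    {n₁ : ℕ} (hn₁ : Squarefree n₁)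
    (hk₁ : ∀ q ∈ n₁.primeFactors, Zhang2014.IsKolyvaginPrime (W.conductorNorm ℤ) W K p q)
    (d₁ : KolyvaginHeegnerData Dt β ι n₁) (hne : d₁.kolyvaginClass hp.out 1 ≠ 0) :
    (W.mordellWeilRank ≤ n₁.primeFactors.card + 1 ∧
        (W.quadraticTwist (NumberField.discr K : ℚ)).mordellWeilRank ≤ n₁.primeFactors.card) ∨
      (W.mordellWeilRank ≤ n₁.primeFactors.card ∧
        (W.quadraticTwist (NumberField.discr K : ℚ)).mordellWeilRank ≤ n₁.primeFactors.card + 1) := by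
  obtain ⟨S, hSel, hSp, hSc, hSK, hSτ⟩ := exists_hypothesesDepth_of_datum_of_hfin h372 hcm hK hD3 hD4 hH p
    hp2 htower c hc hcc hfin hn₁ hk₁ d₁
  have hsupp : KolSupp S.Kol n₁ := by rw [hSK]; exact ⟨hn₁, hk₁⟩
  have hne' : S.c n₁ ≠ 0 := by rw [hSc]; exact hne
  exact rank_le_of_ne_zero_of_hypothesesDepth W K hK.1 c hc p hp2 (pow_one p) S hSel hSp hSτ hsupp hne'

/-- **The same on the Kodaira–Néron cell ((γ) + (KN_p) only).** [cite: Kolyvagin1991MathAnn, Thm. 2.3 and Thm. 4]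
[cite: GrossLMS1991, Prop. 3.7 (2), Prop. 6.2 (1), §10] [cite: SilvermanAEC2009, VII.6.1] -/
theorem rank_le_of_kolyvaginClass_ne_zero_of_datum_kodairaNeron
    (h372 : GrossLMS1991.prop37_2_frobeniusCongruence)
    (hcm : ¬ W.HasCM) (hK : IsImaginaryQuadratic K) (hD3 : NumberField.discr K ≠ -3)
    (hD4 : NumberField.discr K ≠ -4) (hH : SatisfiesHeegnerHypothesis (W.conductorNorm ℤ) K)
    (p : ℕ) [hp : Fact p.Prime] (hp2 : p ≠ 2)
    (htower : ∀ n : ℕ, W.HasSurjectiveModNGaloisRep (p ^ n : ℕ))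
    (c : K ≃ₐ[ℚ] K) (hc : c ≠ 1) (hcc : c * c = 1)
    (hmult : ∀ v : HeightOneSpectrum (𝓞 ℚ), W.HasMultiplicativeReductionAt v →
      ¬ p ∣ W.ordMinimalDiscriminant v)
    (hadd : ∀ v : HeightOneSpectrum (𝓞 ℚ), W.HasAdditiveReductionAt v → p ≠ 3 ∨
      (W.kodairaSymbolAt v ≠ KodairaSymbol.IV ∧ W.kodairaSymbolAt v ≠ KodairaSymbol.IVstar))
    {n₁ : ℕ} (hn₁ : Squarefree n₁)
    (hk₁ : ∀ q ∈ n₁.primeFactors, Zhang2014.IsKolyvaginPrime (W.conductorNorm ℤ) W K p q)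
    (d₁ : KolyvaginHeegnerData Dt β ι n₁) (hne : d₁.kolyvaginClass hp.out 1 ≠ 0) :
    (W.mordellWeilRank ≤ n₁.primeFactors.card + 1 ∧
        (W.quadraticTwist (NumberField.discr K : ℚ)).mordellWeilRank ≤ n₁.primeFactors.card) ∨
      (W.mordellWeilRank ≤ n₁.primeFactors.card ∧
        (W.quadraticTwist (NumberField.discr K : ℚ)).mordellWeilRank ≤ n₁.primeFactors.card + 1) :=
  rank_le_of_kolyvaginClass_ne_zero_of_datum_of_hfin h372 hcm hK hD3 hD4 hH p hp2 htower c hc hcc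
    (fun _n hn hk d v hv ↦ kolyvaginClass_mem_selmerLocalKer_finite_one_of_kodairaNeron hK hD3 hD4 hH
      hp2 (by simpa only [pow_one] using htower 1) Dt β ι hmult hadd hn hk d v hv)
    hn₁ hk₁ d₁ hne

/-- **The same in general, modulo (γ) + F1** (F1 = `Gross1991_heegnerPoint_sub_ratTorsion_mem_E0`).
[cite: Kolyvagin1991MathAnn, Thm. 2.3 and Thm. 4] [cite: GrossLMS1991, Prop. 3.7 (2), Prop. 6.2 (1), §10]
[cite: GrossZagier1986, III (3.1)] -/
theorem rank_le_of_kolyvaginClass_ne_zero_of_datum_gross1991E0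
    (h372 : GrossLMS1991.prop37_2_frobeniusCongruence)
    (hE0 : Gross1991_heegnerPoint_sub_ratTorsion_mem_E0)
    (hcm : ¬ W.HasCM) (hK : IsImaginaryQuadratic K) (hD3 : NumberField.discr K ≠ -3)
    (hD4 : NumberField.discr K ≠ -4) (hH : SatisfiesHeegnerHypothesis (W.conductorNorm ℤ) K)
    (p : ℕ) [hp : Fact p.Prime] (hp2 : p ≠ 2)
    (htower : ∀ n : ℕ, W.HasSurjectiveModNGaloisRep (p ^ n : ℕ))
    (c : K ≃ₐ[ℚ] K) (hc : c ≠ 1) (hcc : c * c = 1)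
    {n₁ : ℕ} (hn₁ : Squarefree n₁)
    (hk₁ : ∀ q ∈ n₁.primeFactors, Zhang2014.IsKolyvaginPrime (W.conductorNorm ℤ) W K p q)
    (d₁ : KolyvaginHeegnerData Dt β ι n₁) (hne : d₁.kolyvaginClass hp.out 1 ≠ 0) :
    (W.mordellWeilRank ≤ n₁.primeFactors.card + 1 ∧
        (W.quadraticTwist (NumberField.discr K : ℚ)).mordellWeilRank ≤ n₁.primeFactors.card) ∨
      (W.mordellWeilRank ≤ n₁.primeFactors.card ∧
        (W.quadraticTwist (NumberField.discr K : ℚ)).mordellWeilRank ≤ n₁.primeFactors.card + 1) :=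
  rank_le_of_kolyvaginClass_ne_zero_of_datum_of_hfin h372 hcm hK hD3 hD4 hH p hp2 htower c hc hcc
    (fun _n hn hk d v hv ↦ kolyvaginClass_mem_selmerLocalKer_finite_one_of_gross1991E0 hE0 hcm hK hD3
      hD4 hH hp2 (by simpa only [pow_one] using htower 1) Dt β ι hn hk d v hv)
    hn₁ hk₁ d₁ hne

/-- **Vanishing below the points, Kodaira–Néron cell — no bit at all.** Same setting on (γ) + (KN_p):
for ANY datum `d₁` of square-free Zhang–Kolyvagin conductor `n₁` with `ν` prime factors, if
`ν + 2 ≤ rank E(ℚ)`, or `ν + 2 ≤ rank E^{(d_K)}(ℚ)`, or `ν + 1 ≤` both ranks, then `c_1(n₁) = 0`. For the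
depth table: on a rank-2 curve every depth-0 class `c_1(1) = δ y_K` vanishes mod `p`; on a rank-3 curve
every `c_1(ℓ)` vanishes — falsifiable predictions, points first. CONDITIONAL on (γ) only; BSD is not
proved by it. [cite: Kolyvagin1991MathAnn, Thm. 2.3 and Thm. 4] [cite: GrossLMS1991, Prop. 3.7 (2), §10] -/
theorem kolyvaginClass_eq_zero_of_rank_of_datum_kodairaNeron
    (h372 : GrossLMS1991.prop37_2_frobeniusCongruence)
    (hcm : ¬ W.HasCM) (hK : IsImaginaryQuadratic K) (hD3 : NumberField.discr K ≠ -3)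
    (hD4 : NumberField.discr K ≠ -4) (hH : SatisfiesHeegnerHypothesis (W.conductorNorm ℤ) K)
    (p : ℕ) [hp : Fact p.Prime] (hp2 : p ≠ 2)
    (htower : ∀ n : ℕ, W.HasSurjectiveModNGaloisRep (p ^ n : ℕ))
    (c : K ≃ₐ[ℚ] K) (hc : c ≠ 1) (hcc : c * c = 1)
    (hmult : ∀ v : HeightOneSpectrum (𝓞 ℚ), W.HasMultiplicativeReductionAt v →
      ¬ p ∣ W.ordMinimalDiscriminant v)
    (hadd : ∀ v : HeightOneSpectrum (𝓞 ℚ), W.HasAdditiveReductionAt v → p ≠ 3 ∨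
      (W.kodairaSymbolAt v ≠ KodairaSymbol.IV ∧ W.kodairaSymbolAt v ≠ KodairaSymbol.IVstar))
    {n₁ : ℕ} (hn₁ : Squarefree n₁)
    (hk₁ : ∀ q ∈ n₁.primeFactors, Zhang2014.IsKolyvaginPrime (W.conductorNorm ℤ) W K p q)
    (d₁ : KolyvaginHeegnerData Dt β ι n₁)
    (hrank : n₁.primeFactors.card + 2 ≤ W.mordellWeilRank ∨
      n₁.primeFactors.card + 2 ≤ (W.quadraticTwist (NumberField.discr K : ℚ)).mordellWeilRank ∨
      (n₁.primeFactors.card + 1 ≤ W.mordellWeilRank ∧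
        n₁.primeFactors.card + 1 ≤ (W.quadraticTwist (NumberField.discr K : ℚ)).mordellWeilRank)) :
    d₁.kolyvaginClass hp.out 1 = 0 := by
  by_contra hne
  rcases rank_le_of_kolyvaginClass_ne_zero_of_datum_kodairaNeron h372 hcm hK hD3 hD4 hH p hp2 htower c
    hc hcc hmult hadd hn₁ hk₁ d₁ hne with ⟨h1, h2⟩ | ⟨h1, h2⟩ <;> omega

/-- **Vanishing below the points in general, modulo (γ) + F1 — no bit at all.**
[cite: Kolyvagin1991MathAnn, Thm. 2.3 and Thm. 4] [cite: GrossLMS1991, Prop. 3.7 (2), Prop. 6.2 (1), §10]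
[cite: GrossZagier1986, III (3.1)] -/
theorem kolyvaginClass_eq_zero_of_rank_of_datum_gross1991E0
    (h372 : GrossLMS1991.prop37_2_frobeniusCongruence)
    (hE0 : Gross1991_heegnerPoint_sub_ratTorsion_mem_E0)
    (hcm : ¬ W.HasCM) (hK : IsImaginaryQuadratic K) (hD3 : NumberField.discr K ≠ -3)
    (hD4 : NumberField.discr K ≠ -4) (hH : SatisfiesHeegnerHypothesis (W.conductorNorm ℤ) K)
    (p : ℕ) [hp : Fact p.Prime] (hp2 : p ≠ 2)
    (htower : ∀ n : ℕ, W.HasSurjectiveModNGaloisRep (p ^ n : ℕ))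
    (c : K ≃ₐ[ℚ] K) (hc : c ≠ 1) (hcc : c * c = 1)
    {n₁ : ℕ} (hn₁ : Squarefree n₁)
    (hk₁ : ∀ q ∈ n₁.primeFactors, Zhang2014.IsKolyvaginPrime (W.conductorNorm ℤ) W K p q)
    (d₁ : KolyvaginHeegnerData Dt β ι n₁)
    (hrank : n₁.primeFactors.card + 2 ≤ W.mordellWeilRank ∨
      n₁.primeFactors.card + 2 ≤ (W.quadraticTwist (NumberField.discr K : ℚ)).mordellWeilRank ∨
      (n₁.primeFactors.card + 1 ≤ W.mordellWeilRank ∧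
        n₁.primeFactors.card + 1 ≤ (W.quadraticTwist (NumberField.discr K : ℚ)).mordellWeilRank)) :
    d₁.kolyvaginClass hp.out 1 = 0 := by
  by_contra hne
  rcases rank_le_of_kolyvaginClass_ne_zero_of_datum_gross1991E0 h372 hE0 hcm hK hD3 hD4 hH p hp2 htower
    c hc hcc hn₁ hk₁ d₁ hne with ⟨h1, h2⟩ | ⟨h1, h2⟩ <;> omega

end Datum

end Summit.BirchSwinnertonDyer.BirchSwinnertonDyer.Theorems.KolyvaginDepthDoor

end
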